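import Mathlib.NumberTheory.Cyclotomic.Basic
import Literature.NumberTheory.EllipticCurves.Rank1Residual.Typed.Basic
import Literature.NumberTheory.EllipticCurves.IwasawaSelmer
import Literature.NumberTheory.DiophantineGeometry.LocalReduction
import HarnessLib

/-!
# Additive classes X3/X4 — the POTENTIALLY GOOD ORDINARY sub-classes X3♯(G-ord), X4♯(G-ord): statements and typed input

HONEST FRAMING (cell `b2b-bsdres`, run/shared/lean/b2b/bsd-rank1-residual/, verbatim in every
file): the goal of the cell is to DELETE the COMBINATION-SHAPED residual classes of the
Birch–Swinnerton-Dyer formula for ALL analytic-rank `≤ 1` elliptic curves over `ℚ` — "full BSD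
formula for every rank `≤ 1` curve in class `C`" assembled STRICTLY from published theorems — so
that the rank-`≤ 1` remainder becomes exactly the CONSTRUCTION-SHAPED classes, which are TYPED
(missing-input `Prop`s), NOT attempted. This is not "finishing BSD". Sub-cell `additive-p2`
(human GO 2026-08-19T21:53Z, part 3: "start working on each class"): classes X3 (`red(p) ∧ add(p)`)
and X4 (`p odd ∧ add(p) ∧ irr(p)`) of RESIDUAL-CASES §a.2 at a prime of ADDITIVE reduction, the
POTENTIALLY GOOD ORDINARY half = the census sub-classes **X3♯(G-ord)** / **X4♯(G-ord)**
(HOME/b2b-bsdres-hyp/hyp/SHARPENED-CONJECTURES.md §3). RESEARCH ROUTE; NO CLAIM BEYOND THE STATED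
CLASSES; both sub-classes stay CONSTRUCTION-SHAPED (this file asserts nothing).

Definitions + bookkeeping theorems only (no named fact). Contents:

* `TypeG W p` — Delbourgo's hypothesis **(G)** (Compositio Math. 113 (1998) §1.5, p. 130:
  "`E` has potential good reduction at `p` and `E` possesses good reduction over a field
  `L ⊂ ℚ_p(μ_p)` where `[L : ℚ_p] = d`"), transcribed GLOBALLY: there is a subfield `F` of a
  `p`-th cyclotomic field `ℚ(ζ_p)` such that `E_F` has good reduction at every place of `F` above
  `p`. (Equivalent to the local statement: `ℚ(ζ_p)/ℚ` is cyclic and totally ramified at `p`, so the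
  subfields `F` of degree `d ∣ p − 1` correspond one-to-one to the subfields `F_w ⊂ ℚ_p(μ_p)` of
  degree `d`, and good reduction of `E_F` at the unique `w ∣ p` is good reduction of `E` over the
  completion `F_w` by the tree's definition `WeierstrassCurve.HasGoodReductionAt`.)
* `TypeGOrd W p` — (G) with good ORDINARY reduction above `p` (the tree's unit-root predicate
  `WeierstrassCurve.HasUnitRootAt` at the same places): the standing hypothesis "`E` has potential
  good ordinary reduction at `p` and satisfies (G)" of Delbourgo's Thm. 3 / Prop. 4 / Main
  Conjecture (pp. 143–144, 151).
* `ClassX3Gord W p := ClassX3 W p ∧ TypeGOrd W p`, `ClassX4Gord W p := ClassX4 W p ∧ TypeGOrd W p` —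
  the sub-classes X3♯(G-ord), X4♯(G-ord).
* `X3Gord.Statement`, `X4Gord.Statement` — the sub-cell's TARGET statements
  `∀ E/ℚ, r_an ≤ 1 → ClassX?Gord E p → BSD(E,p)` (OPEN; `def … : Prop`, never asserted).
* `Gord.MissingInputAt W p` — the TYPED missing input, in the cell's output currency
  (`Typed.MissingPPartAt`: `#Ш_an` rational with `ord_p #Ш_an = ord_p #Ш`), with the missing OBJECT
  named in its docstring; `X3Gord.bsdp_of_missingInputAt`, `X4Gord.bsdp_of_missingInputAt`,
  `X3Gord.statement_of_missingInput`, `X4Gord.statement_of_missingInput` (bookkeeping).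

DATA DICTIONARY (how the census decides the sub-class from Cremona's tables; two engines —
engine A `hyp_bits.py` (j-invariant / Δ_min valuations, supersingular j-polynomial) and engine P
(PARI: Tate's algorithm, `ellissupersingular`) agree on every compared cell, hyp README): at an
additive `p`, `TypeGOrd ⟺ v_p(j) ≥ 0 ∧ j̄ not supersingular`, where `j̄ ∈ 𝔽_p` is the reduction of
`j` (`j̄ = 0` when `v_p(j) > 0`). Justification (Serre–Tate; Silverman ATAEC IV §9 / AEC VII.5.4–5.5):
potentially good reduction is `v_p(j) ≥ 0`; for `p ≥ 5` inertia acts through a cyclic group of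
order `e = 12/gcd(12, v_p(Δ_min)) ∈ {2, 3, 4, 6}` (Kodaira `I₀*` / `IV, IV*` / `III, III*` /
`II, II*`), good reduction is acquired over every tamely ramified extension of ramification index
divisible by `e`, so over a subfield of `ℚ_p(μ_p)` iff `e ∣ p − 1`; the inertia quotient acts
faithfully by automorphisms of the reduced curve `Ẽ/𝔽̄_p`, whence `e ∈ {3, 6} ⇒ j̃ = 0` and
`e = 4 ⇒ j̃ = 1728`, and `Ẽ` (with `j̃ = j̄`) is ordinary iff `p ≡ 1 (mod 3)` resp. `p ≡ 1 (mod 4)`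
— i.e. for `e ∈ {3, 4, 6}` ORDINARY ⟹ `e ∣ p − 1` automatically, and for `e = 2` always
`2 ∣ p − 1`; at `p = 3` every case with `3 ∣ e` or `e = 4` has `j̃ ∈ {0, 1728} = {0}`,
supersingular, so potential good ORDINARY reduction at `3` means `e = 2` (type `I₀*`, the
quadratic twist `E^{(-3)}` good ordinary at `3`). Hence **potentially good ordinary ⟹ (G)** at every
odd `p`, and `TypeGOrd` = "additive, potentially good ordinary". Census (N < 2·10⁴ ‖ N < 10⁴,
pairs; this sub-cell's `census/potgord_census.py` on `hyp_bits.tsv`, reproducing SHARPENED-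
CONJECTURES §3 for X3): X3♯(G-ord) **334 ‖ 191** of X3's 2392 ‖ 1283 (all open: no lever reaches
X3); X4♯(G-ord) **946 ‖ 240** of X4's 4906 ‖ 1337, of which **214 ‖ 44** open after the published
per-pair levers (Kim 2026 Thm. 1.8 rank 0). Kodaira/e profile of the 1280 sub-class pairs:
`I₀*` (e = 2) 681, `III/III*` (e = 4) 265, `IV/IV*` (e = 3) 159, `II/II*` (e = 6) 175; `e ∣ p − 1`
on 1280/1280; at `p = 3` only `I₀*` (421/421).

WHAT IS MISSING (located gap; details HOME/b2b-bsdres-additive-p2/AUDIT-X34-GORD.md). In the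
output currency both halves of `ord_p #Ш = ord_p #Ш_an` are missing CLASS-WIDE; the Euler-system
half is in print PER PAIR for X4 in rank 0 (Kim, Amer. J. Math. 148 (2026) Thm. 1.8: `p ≥ 5`,
surjective `ρ̄`, Manin; any reduction type; tree `Kim2022_rankZero_…`). The missing OBJECT is the
Eisenstein-congruence ("`p`-adic `L`-function divides characteristic ideal") divisibility of a main
conjecture that NO refereed source states at a ramified-at-`p` datum, in three equivalent guises:
(i) Delbourgo's Main Conjecture at an unstable prime of type (G) (Compositio 113 p. 151) together
with the constant-matching "MC ⇒ BSD_p" (loc. cit. p. 124, not printed as a theorem); (ii) for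
`e = 2` (`E = E₁^{(p*)}`, `E₁` good ordinary at `p`) the `ω^{(p−1)/2}`-Teichmüller branch of the
cyclotomic main conjecture of `E₁` over `ℚ(ζ_{p^∞})` — Kato, Astérisque 295 Thm. 17.4 proves the
Euler-system divisibility on EVERY branch, but Skinner–Urban, Invent. Math. 195 (2014) Thm. 3.6.4 /
Cor. 3.6.3 and Wan 2015 Thm. 103 print the converse only for trivial tame character
(`χ = ω^{k−2}χ₁`, `χ₁` of `p`-power order), i.e. the trivial branch; for `e ∈ {3, 4, 6}` the main
conjecture for the `p`-ordinary newform `f_E ⊗ ω^{i}` of nebentypus `ω^{2i} ≠ 1` (SU Thm. 3.6.1: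
"trivial character"); (iii) over a totally real field `F` in which `E` becomes good ordinary above
`p`: the Hilbert-modular main conjecture (Wan, Forum Math. Sigma 3 (2015) e18, §1.1, Thm. 101;
BCS, IMRN 2025 §2.1 (ur)) is printed only for `p` UNRAMIFIED in `F`, while `F` must ramify at `p`
(sibling file `Additive/UnramifiedBaseChange.lean`:
`ramificationIdxIn_ne_one_of_addv_of_isSemistableAt_baseChange`). Independent concurring analysis:
HOME/b2b-bsdres-harvest-2/HARVEST.md §E19.3–E19.6 ("no class-level [MC] source on a Teichmüller
branch `ω^i`, `i ≢ 0`, for non-CM forms").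

References: D. Delbourgo, Compositio Math. 113 (1998) 123–153, §1.5 (G), Thm. 1, Thm. 3, Prop. 4,
§2.5 Main Conjecture; K. Kato, Astérisque 295 (2004) Thm. 17.4; C. Skinner, E. Urban, Invent.
Math. 195 (2014) §3.3.10, Thm. 3.6.1, Cor. 3.6.3, Thm. 3.6.4; X. Wan, Forum Math. Sigma 3 (2015)
e18, §1.1, Thms. 101–103; A. Burungale, F. Castella, C. Skinner, IMRN 2025 §2.1; C.-H. Kim,
Amer. J. Math. 148 (2026) Thm. 1.8; J.-P. Serre, J. Tate, Ann. of Math. 88 (1968) §2;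
J. H. Silverman, AEC VII.5, ATAEC IV §9; RESIDUAL-CASES.md §a.2 rows X3/X4; cell CITED-FACTS C13.
-/

noncomputable section

open scoped Classical NumberField

open WeierstrassCurve IsDedekindDomain NumberField Literature.NumberTheory.EllipticCurves
  Literature.NumberTheory.EllipticCurves.Rank1Residual
  Literature.NumberTheory.EllipticCurves.Rank1Residual.Typed

namespace Summit.BirchSwinnertonDyer.Rank1Residual.Additive

/-! ### Delbourgo's hypothesis (G) and its ordinary form -/

/-- **Hypothesis (G)** (Delbourgo, Compositio Math. 113 (1998) §1.5, p. 130: "`E` has potential good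
reduction at `p` and `E` possesses good reduction over a field `L ⊂ ℚ_p(μ_p)` where
`[L : ℚ_p] = d`"), global transcription: for some `p`-th cyclotomic field `L ⊇ ℚ` and some
intermediate field `F ⊆ L`, the base change `E_F` has good reduction at every place `w` of `F`
above `p` (`(p) ⊆ w`). Equivalent to the local statement because `ℚ(ζ_p)/ℚ` is cyclic, totally
ramified at `p` (module docstring). A predicate on `(W, p)`; nothing asserted. -/
def TypeG (W : WeierstrassCurve ℚ) (p : ℕ) : Prop :=
  ∃ (L : Type) (_ : Field L) (_ : NumberField L) (_ : IsCyclotomicExtension {p} ℚ L)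
    (F : IntermediateField ℚ L),
    ∀ w : HeightOneSpectrum (𝓞 F), (p : 𝓞 F) ∈ w.asIdeal → (W.baseChange F).HasGoodReductionAt w

/-- **(G) with potential good ORDINARY reduction** — the standing hypothesis "`E` has potential
good ordinary reduction at `p` and satisfies (G)" of Delbourgo 1998, Thm. 3, Prop. 4 and the Main
Conjecture (pp. 143, 144, 151): a subfield `F` of a `p`-th cyclotomic field over which `E_F` has
good reduction with the unit-root (ordinary) condition (`WeierstrassCurve.HasUnitRootAt`:
`p ∤ a_w`) at every place above `p`. By the data dictionary of the module docstring this is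
"additive-or-not, potentially good ORDINARY at `p`" for odd `p` (ordinary forces `e ∣ p − 1`).
A predicate on `(W, p)`; nothing asserted. -/
def TypeGOrd (W : WeierstrassCurve ℚ) (p : ℕ) : Prop :=
  ∃ (L : Type) (_ : Field L) (_ : NumberField L) (_ : IsCyclotomicExtension {p} ℚ L)
    (F : IntermediateField ℚ L),
    ∀ w : HeightOneSpectrum (𝓞 F), (p : 𝓞 F) ∈ w.asIdeal →
      (W.baseChange F).HasGoodReductionAt w ∧ (W.baseChange F).HasUnitRootAt w

/-- (G)-ordinary implies (G). -/
theorem TypeGOrd.typeG {W : WeierstrassCurve ℚ} {p : ℕ} (h : TypeGOrd W p) : TypeG W p := by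
  obtain ⟨L, iF, iN, iC, F, hF⟩ := h
  exact ⟨L, iF, iN, iC, F, fun w hw ↦ (hF w hw).1⟩

/-! ### The sub-classes X3♯(G-ord), X4♯(G-ord) -/

variable (W : WeierstrassCurve ℚ) (p : ℕ) [Fact p.Prime]

/-- **X3♯(G-ord)** (SHARPENED-CONJECTURES §3; CLASS-OWNERS row "X3/X4 additive — pot. good ordinary
/ X3♯(G-ord)"): the tree's class X3 (`Red W p ∧ Addv W p`: Eisenstein additive `p`) AND potential
good ordinary reduction of type (G) at `p`. Census: 334 ‖ 191 pairs (N < 2·10⁴ ‖ N < 10⁴), all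
open. Label: CONSTRUCTION-SHAPED. [sub-class predicate; nothing asserted] -/
def ClassX3Gord : Prop := ClassX3 W p ∧ TypeGOrd W p

/-- **X4♯(G-ord)**: the tree's class X4 (`p ≠ 2 ∧ Addv W p ∧ Irr W p`) AND potential good ordinary
reduction of type (G) at `p`. Census: 946 ‖ 240 pairs, 214 ‖ 44 open after the published per-pair
levers. Label: CONSTRUCTION-SHAPED. [sub-class predicate; nothing asserted] -/
def ClassX4Gord : Prop := ClassX4 W p ∧ TypeGOrd W p

variable {W p}

/-- X3♯(G-ord) ⊆ X3. -/
theorem ClassX3Gord.classX3 (h : ClassX3Gord W p) : ClassX3 W p := h.1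

/-- X3♯(G-ord) pairs are of type (G)-ordinary. -/
theorem ClassX3Gord.typeGOrd (h : ClassX3Gord W p) : TypeGOrd W p := h.2

/-- X3♯(G-ord) pairs are additive at `p`. -/
theorem ClassX3Gord.addv (h : ClassX3Gord W p) : Addv W p := h.1.2

/-- X4♯(G-ord) ⊆ X4. -/
theorem ClassX4Gord.classX4 (h : ClassX4Gord W p) : ClassX4 W p := h.1

/-- X4♯(G-ord) pairs are of type (G)-ordinary. -/
theorem ClassX4Gord.typeGOrd (h : ClassX4Gord W p) : TypeGOrd W p := h.2

/-- X4♯(G-ord) pairs are additive at an odd `p`. -/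
theorem ClassX4Gord.addv (h : ClassX4Gord W p) : p ≠ 2 ∧ Addv W p := ⟨h.1.1, h.1.2.1⟩

/-! ### The sub-cell's target statements (OPEN — definitions, never asserted) -/

/-- **Target of sub-cell additive-p2, class X3♯(G-ord)** (OPEN PROBLEM; CONSTRUCTION-SHAPED; research
route, no claim): for every elliptic curve `E/ℚ` (globally minimal model `W`) of analytic rank `≤ 1`
and every prime `p` with `(E, p) ∈ X3♯(G-ord)`, Miller's `BSD(E,p)` holds. Nothing in print implies
it (module docstring, WHAT IS MISSING); recorded as a `Prop`, not a theorem. -/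
def X3Gord.Statement : Prop :=
  ∀ (W : WeierstrassCurve ℚ) [W.IsElliptic] [W.IsGloballyMinimal] (p : ℕ) [Fact p.Prime],
    W.analyticRank ≤ 1 → ClassX3Gord W p → BSDp W p

/-- **Target of sub-cell additive-p2, class X4♯(G-ord)** (OPEN PROBLEM; CONSTRUCTION-SHAPED; research
route, no claim): for every `E/ℚ` of analytic rank `≤ 1` and every prime `p` with
`(E, p) ∈ X4♯(G-ord)`, `BSD(E,p)` holds. Per pair, rank 0, `p ≥ 5`, surjective `ρ̄`, Manin, the
Euler-system inequality is Kim 2026 Thm. 1.8; the class-wide statement is not in print. -/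
def X4Gord.Statement : Prop :=
  ∀ (W : WeierstrassCurve ℚ) [W.IsElliptic] [W.IsGloballyMinimal] (p : ℕ) [Fact p.Prime],
    W.analyticRank ≤ 1 → ClassX4Gord W p → BSDp W p

/-! ### The typed missing input and the conditional theorems -/

/-- **The missing input at a (G)-ordinary additive pair, typed** (both X3♯(G-ord) and X4♯(G-ord)).
OUTPUT currency (cell convention, `Typed.MissingPPartAt`): `#Ш(E/ℚ)_an` is a rational `q` with
`ord_p q = ord_p #Ш(E/ℚ)`. The OBJECT that would deliver it and is NOT in print in any guise (module
docstring): the Eisenstein-congruence divisibility of Delbourgo's Main Conjecture at the unstable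
prime `p` of type (G) (Compositio 113 p. 151) plus its constant-matching to `BSD(E,p)` — equivalently,
for `e = 2`, the `ω^{(p−1)/2}`-branch of the cyclotomic main conjecture of the good-ordinary twist
`E^{(p*)}` (Kato Thm. 17.4 gives the Euler-system half on every branch; Skinner–Urban Thm. 3.6.4 /
Cor. 3.6.3 only the trivial branch), for `e ∈ {3,4,6}` the main conjecture for the ordinary form
`f_E ⊗ ω^i` of nebentypus `ω^{2i}`; and, over a totally real `F ∋` good ordinary reduction above `p`,
Wan 2015 Thm. 101 / BCS 2025 Conj. 2.2.1 WITHOUT their hypothesis "`p` unramified in `F`". A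
predicate; nothing asserted. -/
def Gord.MissingInputAt (W : WeierstrassCurve ℚ) (p : ℕ) : Prop := MissingPPartAt W p

/-- Unfolding: the typed input IS the cell's output currency `MissingPPartAt`. -/
theorem Gord.missingInputAt_iff (W : WeierstrassCurve ℚ) (p : ℕ) :
    Gord.MissingInputAt W p ↔ MissingPPartAt W p := Iff.rfl

/-- **X3♯(G-ord) conditional theorem**: in analytic rank `≤ 1`, the typed missing input at an
X3♯(G-ord) pair yields `BSD(E,p)` (Gross–Zagier–Kolyvagin `hGZK` = bsd.S17 for rank and finiteness,
as in every typed class file of the cell). -/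
theorem X3Gord.bsdp_of_missingInputAt (hGZK : rank_eq_analyticRank_of_analyticRank_le_one)
    (W : WeierstrassCurve ℚ) [W.IsElliptic] [W.IsGloballyMinimal] (p : ℕ) [Fact p.Prime]
    (hr : W.analyticRank ≤ 1) (_hX : ClassX3Gord W p) (hmiss : Gord.MissingInputAt W p) :
    BSDp W p :=
  bsdp_of_missingPPartAt W p hGZK hr hmiss

/-- **X4♯(G-ord) conditional theorem**: in analytic rank `≤ 1`, the typed missing input at an
X4♯(G-ord) pair yields `BSD(E,p)`. -/
theorem X4Gord.bsdp_of_missingInputAt (hGZK : rank_eq_analyticRank_of_analyticRank_le_one)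
    (W : WeierstrassCurve ℚ) [W.IsElliptic] [W.IsGloballyMinimal] (p : ℕ) [Fact p.Prime]
    (hr : W.analyticRank ≤ 1) (_hX : ClassX4Gord W p) (hmiss : Gord.MissingInputAt W p) :
    BSDp W p :=
  bsdp_of_missingPPartAt W p hGZK hr hmiss

/-- **What closes the X3♯(G-ord) target**: the missing input at every X3♯(G-ord) pair of analytic
rank `≤ 1` (and GZK). Bookkeeping: this is the exact shape a future theorem must have. -/
theorem X3Gord.statement_of_missingInput (hGZK : rank_eq_analyticRank_of_analyticRank_le_one)
    (h : ∀ (W : WeierstrassCurve ℚ) [W.IsElliptic] [W.IsGloballyMinimal] (p : ℕ) [Fact p.Prime],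
      W.analyticRank ≤ 1 → ClassX3Gord W p → Gord.MissingInputAt W p) :
    X3Gord.Statement :=
  fun W _ _ p _ hr hX ↦ X3Gord.bsdp_of_missingInputAt hGZK W p hr hX (h W p hr hX)

/-- **What closes the X4♯(G-ord) target**: the missing input at every X4♯(G-ord) pair of analytic
rank `≤ 1` (and GZK). -/
theorem X4Gord.statement_of_missingInput (hGZK : rank_eq_analyticRank_of_analyticRank_le_one)
    (h : ∀ (W : WeierstrassCurve ℚ) [W.IsElliptic] [W.IsGloballyMinimal] (p : ℕ) [Fact p.Prime],
      W.analyticRank ≤ 1 → ClassX4Gord W p → Gord.MissingInputAt W p) :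
    X4Gord.Statement :=
  fun W _ _ p _ hr hX ↦ X4Gord.bsdp_of_missingInputAt hGZK W p hr hX (h W p hr hX)

/-- Conversely the target gives the missing input back at every pair of the sub-class (so the typed
input is not weaker than needed): `BSD(E,p)` with `Ш` finite yields `MissingPPartAt`. -/
theorem X3Gord.missingInput_of_statement (hGZK : rank_eq_analyticRank_of_analyticRank_le_one)
    (h : X3Gord.Statement) (W : WeierstrassCurve ℚ) [W.IsElliptic] [W.IsGloballyMinimal]
    (p : ℕ) [Fact p.Prime] (hr : W.analyticRank ≤ 1) (hX : ClassX3Gord W p) :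
    Gord.MissingInputAt W p := by
  haveI : Finite W.sha := (hGZK W hr).2
  exact missingPPartAt_of_bsdp W p (h W p hr hX)

/-- Converse for X4♯(G-ord): the target gives the missing input back at every pair. -/
theorem X4Gord.missingInput_of_statement (hGZK : rank_eq_analyticRank_of_analyticRank_le_one)
    (h : X4Gord.Statement) (W : WeierstrassCurve ℚ) [W.IsElliptic] [W.IsGloballyMinimal]
    (p : ℕ) [Fact p.Prime] (hr : W.analyticRank ≤ 1) (hX : ClassX4Gord W p) :
    Gord.MissingInputAt W p := by
  haveI : Finite W.sha := (hGZK W hr).2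
  exact missingPPartAt_of_bsdp W p (h W p hr hX)

end Summit.BirchSwinnertonDyer.Rank1Residual.Additive

end
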